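import Mathlib
import HarnessLib
import Summits.Ventures.LatticeQCDFlow.Scaling.PlaquetteIndependence2D
import Summits.Ventures.LatticeQCDFlow.Scaling.IdentityFlowStrongCoupling
import Summits.Ventures.LatticeQCDFlow.TrivializingMaps.PlaquetteDecorrelation

/-!
# LatticeQCDFlow / Scaling — STRONG COUPLING IS EXTENSIVE: for the untrained sampler of Wilson lattice gauge
# theory on `(ℤ/L)^d` (every `d`, every compact `G`) the ESS deficit is `#plaquettes·σ²·β² + o(β²)` and the
# acceptance-ceiling deficit a quarter of it, `σ² = Var_Haar(Re tr ρ)`; on the 2-d torus `#plaquettes = L²`,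
# where moreover distinct plaquettes are fully INDEPENDENT under product Haar

HONEST FRAMING: exact (Metropolis-corrected) sampling algorithms for lattice gauge theory;
figures of merit are autocorrelation/cost numbers at stated couplings and volumes; no
continuum-physics claim.

Venture `LatticeQCDFlow` (cell pub-lqcd), topic `Scaling`; FANOUT row 3 (`s0-u1-a`, S0-B
implementation A, GEN-21).  NEW WORK of the cell, no numerics, NO definition — a junction of two tree
theorems: GEN-16's strong-coupling law (`Scaling/IdentityFlowStrongCoupling.wilsonIdentityFlow_one_sub_essFrac_div_sq_tendsto`:
`(1 − Z(β)²/Z(2β))/β² → Var_{Haar^{⊗E}}(S)`, ceiling `→ Var(S)/4`, coefficient left unevaluated) and the flow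
seat's `TrivializingMaps/PlaquetteDecorrelation.variance_wilsonAction_eq_card_mul` (`Var_{Haar^{⊗E}}(S) =
#plaquettes · Var_Haar(Re tr ρ)` in EVERY dimension, `L ≥ 2`: distinct plaquettes are decorrelated for class
functions by a fresh-link conjugation).  Together (§2): at strong coupling the untrained exact sampler behaves,
to second order in `β`, as `#plaquettes` INDEPENDENT plaquettes — in every dimension, although for `d ≥ 3`
(and on the 2-d torus, by one constraint) the plaquettes are not independent.  §1 records the stronger 2-d fact
behind row 3's torus files: distinct plaquettes of `(ℤ/L)²` are independent as `G`-valued random variables.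

* §1 (2-d) `exists_site_ne_ne`, `map_plaquetteHolonomy_eq_haar_two` (each plaquette is Haar distributed —
  measure form of `TrivializingMaps.integral_comp_plaquetteHolonomy_eq_haar_group`),
  **`indepFun_plaquetteHolonomy_two`** (distinct plaquettes of `(ℤ/L)²`, `L ≥ 2`, are independent under
  `Haar^{⊗E}`: both lie off a common puncture, row 30's `map_plaquettes_eq_pi`);
* §2 (every `d`) `card_plaquette_two` (`#plaquettes = L²` in `d = 2`), **`wilsonIdentityFlow_one_sub_essFrac_div_sq_tendsto_card`**
  (`(1 − ESS)/β² → #plaquettes·σ²`), **`wilsonIdentityFlow_one_sub_bhattSq_div_sq_tendsto_card`** (`→ #plaquettes·σ²/4`),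
  and on the 2-d torus **`torus_one_sub_essFrac_div_sq_tendsto`** (`→ L²σ²`), **`torus_one_sub_bhattSq_div_sq_tendsto`**
  (`→ L²σ²/4`) — versus `(L² − 1)σ²` for the factorised comparison model of `Scaling/TorusEssLossSandwich2D`:
  at fixed volume and `β → 0` the torus is `L²` independent plaquettes to second order, exactly.

NOT CLAIMED: higher orders in `β` (the global constraint of the 2-d torus enters where all `L²` plaquettes meet);
the values of `σ²` (row 3's `Scaling/TorusDiagonalLimitGroups`: `1/2`, `1`, `1/2` for U(1), SU(2), SU(N ≥ 3));
any value at the cell's `(β, L)`; nothing re-scored, SEALED.md untouched.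
-/

noncomputable section

namespace Summit.Ventures.LatticeQCDFlow.Theory2

open MeasureTheory ProbabilityTheory Filter Finset Real Set
open Literature.MathematicalPhysics.QuantumFieldTheory
open Lattice.TwoDim
open scoped Topology

/-! ## §1 Pairwise independence of the plaquettes of `(ℤ/L)²` -/

section Pairwise

variable {L : ℕ} {G : Type*} [Group G] [TopologicalSpace G] [IsTopologicalGroup G]
  [CompactSpace G] [SecondCountableTopology G] [MeasurableSpace G] [BorelSpace G]

omit [Group G] [TopologicalSpace G] [IsTopologicalGroup G] [CompactSpace G] [SecondCountableTopology G]
  [MeasurableSpace G] [BorelSpace G] in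
/-- On `(ℤ/L)²` with `L ≥ 2` there is a site different from any two given ones (`L² ≥ 4`). [folklore] -/
theorem exists_site_ne_ne [NeZero L] (hL : 2 ≤ L) (x y : Site 2 L) : ∃ x₀ : Site 2 L, x₀ ≠ x ∧ x₀ ≠ y := by
  classical
  have hcard : 3 ≤ Fintype.card (Site 2 L) := by
    rw [Fintype.card_fun, ZMod.card, Fintype.card_fin]
    nlinarith
  have h2 : 1 ≤ ((Finset.univ.erase x).erase y).card := by
    have hx := Finset.card_erase_of_mem (Finset.mem_univ x)
    have hy : ((Finset.univ.erase x).erase y).card ≥ (Finset.univ.erase x).card - 1 :=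
      Finset.pred_card_le_card_erase
    rw [Finset.card_univ] at hx
    omega
  obtain ⟨x₀, hx₀⟩ := Finset.card_pos.1 (by omega : 0 < ((Finset.univ.erase x).erase y).card)
  simp only [Finset.mem_erase, Finset.mem_univ, and_true] at hx₀
  exact ⟨x₀, hx₀.2, hx₀.1⟩

/-- **Each plaquette of `(ℤ/L)²` is Haar distributed** under product Haar on the links (`L ≥ 2`): the law of
`U ↦ U_x` is `Haar`. [folklore] -/
theorem map_plaquetteHolonomy_eq_haar_two [NeZero L] (hL : 2 ≤ L) (x : Site 2 L) :
    (Measure.pi fun _ : Edge 2 L => haarProbability G).map (fun U => plaquetteHolonomy U x 0 1) =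
      haarProbability G := by
  obtain ⟨x₀, hx₀, -⟩ := exists_site_ne_ne hL x x
  have hplq : Measurable fun (U : GaugeConfig 2 L G) (y : {y : Site 2 L // y ≠ x₀}) =>
      plaquetteHolonomy U y.1 0 1 :=
    measurable_pi_lambda _ fun y => Lattice.TwoDim.measurable_plaquetteHolonomy (G := G) y.1
  have hfac : (fun U : GaugeConfig 2 L G => plaquetteHolonomy U x 0 1) =
      (fun y : {y : Site 2 L // y ≠ x₀} → G => y ⟨x, hx₀.symm⟩) ∘
        fun (U : GaugeConfig 2 L G) (y : {y : Site 2 L // y ≠ x₀}) => plaquetteHolonomy U y.1 0 1 := rfl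
  rw [hfac, ← Measure.map_map (measurable_pi_apply _) hplq, map_plaquettes_eq_pi hL x₀]
  exact (measurePreserving_eval (fun _ : {y : Site 2 L // y ≠ x₀} => haarProbability G) ⟨x, hx₀.symm⟩).map_eq

/-- **DISTINCT PLAQUETTES OF `(ℤ/L)²` ARE INDEPENDENT** under product Haar on the links (`L ≥ 2`): both lie off a
common puncture, where row 30's `map_plaquettes_eq_pi` makes the punctured plaquette field i.i.d. Haar.
[ours] -/
theorem indepFun_plaquetteHolonomy_two [NeZero L] (hL : 2 ≤ L) {x y : Site 2 L} (hxy : x ≠ y) :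
    IndepFun (fun U : GaugeConfig 2 L G => plaquetteHolonomy U x 0 1)
      (fun U : GaugeConfig 2 L G => plaquetteHolonomy U y 0 1)
      (Measure.pi fun _ : Edge 2 L => haarProbability G) := by
  obtain ⟨x₀, hx, hy⟩ := exists_site_ne_ne hL x y
  have hplq : Measurable fun (U : GaugeConfig 2 L G) (z : {z : Site 2 L // z ≠ x₀}) =>
      plaquetteHolonomy U z.1 0 1 :=
    measurable_pi_lambda _ fun z => Lattice.TwoDim.measurable_plaquetteHolonomy (G := G) z.1
  -- the coordinate maps of the product are independent
  have hind : IndepFun (fun w : {z : Site 2 L // z ≠ x₀} → G => w ⟨x, hx.symm⟩)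
      (fun w : {z : Site 2 L // z ≠ x₀} → G => w ⟨y, hy.symm⟩)
      (Measure.pi fun _ : {z : Site 2 L // z ≠ x₀} => haarProbability G) := by
    have h := iIndepFun_pi (μ := fun _ : {z : Site 2 L // z ≠ x₀} => haarProbability G)
      (X := fun _ (g : G) => g) (fun _ => aemeasurable_id)
    exact h.indepFun (fun heq => hxy (congrArg Subtype.val heq))
  rw [← map_plaquettes_eq_pi hL x₀, indepFun_iff_measure_inter_preimage_eq_mul] at hind
  rw [indepFun_iff_measure_inter_preimage_eq_mul]
  intro s t hs ht
  have h' := hind s t hs ht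
  rw [Measure.map_apply hplq ((measurable_pi_apply _ hs).inter (measurable_pi_apply _ ht)),
    Measure.map_apply hplq (measurable_pi_apply _ hs), Measure.map_apply hplq (measurable_pi_apply _ ht)] at h'
  exact h'

end Pairwise

/-! ## §2 Strong coupling is extensive: every dimension, and the 2-d torus -/

section StrongCoupling

variable {d L N : ℕ} {G : Type*} [Group G] [TopologicalSpace G] [IsTopologicalGroup G]
  [CompactSpace G] [SecondCountableTopology G] [MeasurableSpace G] [BorelSpace G]
  (ρ : G →* Matrix (Fin N) (Fin N) ℂ)

omit [Group G] [TopologicalSpace G] [IsTopologicalGroup G] [CompactSpace G] [SecondCountableTopology G]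
  [MeasurableSpace G] [BorelSpace G] in
/-- In two dimensions `#plaquettes = L²` (one coordinate plane). [folklore] -/
theorem card_plaquette_two [NeZero L] : Fintype.card (Plaquette 2 L) = L ^ 2 := by
  have h1 : Fintype.card {p : Fin 2 × Fin 2 // p.1 < p.2} = 1 :=
    Fintype.card_eq_one_iff.2 ⟨⟨((0 : Fin 2), (1 : Fin 2)), by decide⟩, fun p => plane_eq_zero_one p⟩
  rw [Fintype.card_prod, h1, Fintype.card_fun, ZMod.card, Fintype.card_fin, mul_one]

/-- **STRONG COUPLING IS EXTENSIVE, ESS** (every `d`, `L ≥ 2`, every compact second-countable `G`, continuous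
`ρ`): `(1 − Z(β)²/Z(2β))/β² → #plaquettes · Var_Haar(Re tr ρ)` as `β → 0` — GEN-16's law with the flow seat's
variance of the action. [ours] -/
theorem wilsonIdentityFlow_one_sub_essFrac_div_sq_tendsto_card [NeZero L] (hL : 2 ≤ L) (hρ : Continuous ρ) :
    Tendsto (fun β : ℝ => (1 - (partitionFunction (d := d) (L := L) ρ β).toReal ^ 2
        / (partitionFunction (d := d) (L := L) ρ (2 * β)).toReal) / β ^ 2) (𝓝[≠] 0)
      (𝓝 (Fintype.card (Plaquette d L) * Var[fun g : G => (ρ g).trace.re; haarProbability G])) := by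
  have h := wilsonIdentityFlow_one_sub_essFrac_div_sq_tendsto (d := d) (L := L) ρ hρ
  have hv := TrivializingMaps.variance_wilsonAction_eq_card_mul (d := d) (L := L) (G := G) ρ hρ hL
  rw [show Luscher2010.trivialMeasure G d L = Measure.pi fun _ : Edge d L => haarProbability G from rfl] at hv
  rwa [show (fun U : GaugeConfig d L G => wilsonAction ρ U) = wilsonAction ρ from rfl, hv] at h

/-- **STRONG COUPLING IS EXTENSIVE, CEILING**: `(1 − Z(β/2)²/Z(β))/β² → #plaquettes · Var_Haar(Re tr ρ)/4`. [ours] -/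
theorem wilsonIdentityFlow_one_sub_bhattSq_div_sq_tendsto_card [NeZero L] (hL : 2 ≤ L) (hρ : Continuous ρ) :
    Tendsto (fun β : ℝ => (1 - (partitionFunction (d := d) (L := L) ρ (β / 2)).toReal ^ 2
        / (partitionFunction (d := d) (L := L) ρ β).toReal) / β ^ 2) (𝓝[≠] 0)
      (𝓝 (Fintype.card (Plaquette d L) * Var[fun g : G => (ρ g).trace.re; haarProbability G] / 4)) := by
  have h := wilsonIdentityFlow_one_sub_bhattSq_div_sq_tendsto (d := d) (L := L) ρ hρ
  have hv := TrivializingMaps.variance_wilsonAction_eq_card_mul (d := d) (L := L) (G := G) ρ hρ hL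
  rw [show Luscher2010.trivialMeasure G d L = Measure.pi fun _ : Edge d L => haarProbability G from rfl] at hv
  rwa [show (fun U : GaugeConfig d L G => wilsonAction ρ U) = wilsonAction ρ from rfl, hv] at h

/-- **THE 2-d TORUS AT STRONG COUPLING IS `L²` INDEPENDENT PLAQUETTES TO SECOND ORDER, ESS**:
`(1 − ESS_T(β))/β² → L²·Var_Haar(Re tr ρ)`. [ours] -/
theorem torus_one_sub_essFrac_div_sq_tendsto [NeZero L] (hL : 2 ≤ L) (hρ : Continuous ρ) :
    Tendsto (fun β : ℝ => (1 - (partitionFunction (d := 2) (L := L) ρ β).toReal ^ 2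
        / (partitionFunction (d := 2) (L := L) ρ (2 * β)).toReal) / β ^ 2) (𝓝[≠] 0)
      (𝓝 ((L : ℝ) ^ 2 * Var[fun g : G => (ρ g).trace.re; haarProbability G])) := by
  have h := wilsonIdentityFlow_one_sub_essFrac_div_sq_tendsto_card (d := 2) ρ hL hρ
  rw [card_plaquette_two] at h
  exact_mod_cast h

/-- **… CEILING**: `(1 − Z(β/2)²/Z(β))/β² → L²·Var_Haar(Re tr ρ)/4` on the 2-d torus. [ours] -/
theorem torus_one_sub_bhattSq_div_sq_tendsto [NeZero L] (hL : 2 ≤ L) (hρ : Continuous ρ) :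
    Tendsto (fun β : ℝ => (1 - (partitionFunction (d := 2) (L := L) ρ (β / 2)).toReal ^ 2
        / (partitionFunction (d := 2) (L := L) ρ β).toReal) / β ^ 2) (𝓝[≠] 0)
      (𝓝 ((L : ℝ) ^ 2 * Var[fun g : G => (ρ g).trace.re; haarProbability G] / 4)) := by
  have h := wilsonIdentityFlow_one_sub_bhattSq_div_sq_tendsto_card (d := 2) ρ hL hρ
  rw [card_plaquette_two] at h
  exact_mod_cast h

end StrongCoupling

end Summit.Ventures.LatticeQCDFlow.Theory2

end
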